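import Literature.Probability.RandomPlanarGeometry.HexSAWIrreducibleBridges
import Literature.Probability.RandomPlanarGeometry.HexSAWStripIdentity
import Literature.Probability.Process.RenewalSequenceRecurrence
import HarnessLib

/-!
# Kesten's identity on the hexagonal lattice: the critical irreducible bridges sum to one, `Σ_T I_T(x_c) = 1`

Topic `Literature/Probability/RandomPlanarGeometry` (continues `HexSAWIrreducibleBridges.lean`).  Sources: H. Kesten,
*On the number of self-avoiding walks*, J. Math. Phys. 4 (1963) 960–969, §4 (the renewal identity for irreducible
bridges, `Σₙ λₙ μ⁻ⁿ = 1` on `ℤᵈ`); N. Madras, G. Slade, *The Self-Avoiding Walk* (1993), §4.2 (the renewal equation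
(4.2.2), p. 90, and Kesten's relation (4.2.4), p. 91: "B_z diverges at z_c (Corollary 3.1.8), so in fact
Λ_{z_c} = 1; that is, Σ_k λ_k/μ^k = 1"); W. Feller, *An Introduction to Probability Theory and Its Applications* I (1968), XIII.3
(recurrent renewal sequences: `Σ uₙ = ∞ ⇒ Σ fₖ = 1`, `Literature.Probability.Process.Renewal.hasSum_f_one`); and, for
the input `Σ_T B_T(x_c) = +∞` on the hexagonal lattice, H. Duminil-Copin, S. Smirnov, Ann. of Math. 175 (2012), §3
(`tendsto_sum_stripBlim_atTop` of `HexSAWStripIdentity.lean`, where this identity is flagged as the next step).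
The identity proved here is STATED in print for the honeycomb lattice, in this strip frame and without a written
proof, by N. R. Beaton, M. Bousquet-Mélou, J. de Gier, H. Duminil-Copin, A. J. Guttmann, Comm. Math. Phys. 326 (2014)
727–754 (arXiv:1109.0358), Appendix, paragraph before Lemma 11: "Kesten's relation for irreducible bridges (see
[MS93] or [Kesten63]) on the hypercubic lattice ℤ^d can be easily adapted to the honeycomb lattice. It gives
Σ_{γ ∈ iSAB} x_c^{|γ|} = 1" (grouped by the height `T` of `γ` this is `Σ_T I_T(x_c) = 1`); they use it to define
the measure `P_iSAB` and, via their Lemma 11 (renewal theorem), to rephrase `B_T(x_c) → 0` (their Theorem 10) as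
`E_iSAB(height) = ∞` — the null recurrence recorded below as `not_summable_width_mul_stripIlim`.

Contents (namespace `Literature.Probability.RandomPlanarGeometry.SAW.HV`, all at `x = x_c` unless stated):

* `stripB_le_cut` — the finite-volume CUTTING inequality `B_{T,L} ≤ I_{T,L} + Σ_{1 ≤ t < T} I_{t,L} B_{T-t,2L+T}`
  (`x ≥ 0`; cut a reducible bridge at its first renewal level; the cutting map `l ↦ (low t l, highStd t l)` is
  injective, `eq_of_low_eq_of_highStd_eq`);
* `stripIlim T = I_T(x_c) := sup_L I_{T,L}(x_c)` with `stripI_le_lim`, `tendsto_stripI`, `0 ≤ I_T ≤ 1`;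
* **`renewal_equation`** — `B_T = I_T + Σ_{1 ≤ t < T} I_t B_{T-t}` (`T ≥ 1`), from the cutting inequality and the
  concatenation inequality `sum_brConcat_le_stripB` in the limit `L → ∞`; `renewal_equation_range` (Feller's indexing);
* `not_summable_bridgeSeq` — `Σ_T B_T(x_c) = ∞` in the form needed;
* **`hasSum_stripIlim`**, `tsum_stripIlim` — KESTEN'S IDENTITY `Σ_{T ≥ 1} I_T(x_c) = 1`: at the critical fugacity the
  irreducible bridges of the strip form a probability distribution (the bridge decomposition is a recurrent renewal
  structure) — the lattice input of every renewal / regeneration argument for the critical hexagonal SAW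
  (e.g. Kesten's construction of the infinite bridge, Madras–Slade §8.3);
* `not_summable_width_mul_stripIlim` — NULL RECURRENCE: the critical irreducible bridges have infinite mean width
  `Σ_T T·I_T(x_c) = ∞` (recurrence + `B_T(x_c) → 0` + `Renewal.not_summable_mul_of_tendsto_zero`).
-/

noncomputable section

open Finset Literature.Probability.LatticeModels

namespace Literature.Probability.RandomPlanarGeometry.SAW

namespace HV

/-! ### The cutting map at the first renewal level -/

/-- `high = highStd` translated back. [folklore] -/
theorem high_eq_map_highStd (t : ℕ) (l : List HV) : high t l = (highStd t l).map (shift (jx t l) t) := by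
  rw [highStd, List.map_map]
  conv_lhs => rw [← List.map_id (high t l)]
  refine List.map_congr_left fun v _ => ?_
  obtain ⟨a, b, c⟩ := v
  simp

/-- `|l| = |low t l| + |highStd t l|`. [folklore] -/
theorem length_eq_low_add_highStd (t : ℕ) (l : List HV) : l.length = (low t l).length + (highStd t l).length := by
  rw [highStd, List.length_map, ← List.length_append, low_append_high]

/-- The cutting map is injective: a list is determined by its low piece and its translated high piece.
[cite: Kesten1963SAW, §4; MadrasSlade1993, §4.2] -/
theorem eq_of_low_eq_of_highStd_eq {t : ℕ} {l l' : List HV} (h1 : low t l = low t l') (h2 : highStd t l = highStd t l') :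
    l = l' := by
  have hj : jx t l = jx t l' := by rw [jx, jx, h1]
  rw [← low_append_high t l, ← low_append_high t l', high_eq_map_highStd, high_eq_map_highStd, h1, h2, hj]

/-- **The cutting inequality** (finite volume): for `T ≥ 1` and `x ≥ 0`,
`B_{T,L}(x) ≤ I_{T,L}(x) + Σ_{1 ≤ t < T} I_{t,L}(x) · B_{T-t,2L+T}(x)` — cut a reducible bridge at its first renewal
level into an irreducible bridge of width `t` of `S_{t,L}` and a translated bridge of width `T-t` of `S_{T-t,2L+T}`,
injectively. [cite: Kesten1963SAW, §4; MadrasSlade1993, (4.2.2)] -/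
theorem stripB_le_cut {T : ℕ} (hT : 1 ≤ T) (L : ℕ) {x : ℝ} (hx : 0 ≤ x) :
    stripB T L x ≤ stripI T L x + ∑ t ∈ Ico 1 T, stripI t L x * stripB (T - t) (2 * L + T) x := by
  rw [stripB_eq_sum_firstRen hT L, sum_Icc_eq_sum_Ico_add hT, add_comm]
  refine add_le_add (le_of_eq ?_) (sum_le_sum fun t ht => ?_)
  · -- the fibre `firstRen = T` is exactly the set of irreducible bridges
    rw [stripI, irrLists]
    refine sum_congr ?_ fun _ _ => rfl
    ext l
    simp only [mem_filter, and_congr_right_iff]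
    exact fun _ => ⟨isIrred_of_firstRen_eq, firstRen_of_isIrred⟩
  · rw [mem_Ico] at ht
    have ht1 : 1 ≤ t := ht.1
    have htT : t < T := ht.2
    rw [stripI, stripB_eq_sum_bridgeLists (by omega : 1 ≤ T - t), sum_mul_sum, ← sum_product']
    have heq : ∀ l ∈ (bridgeLists T L).filter (fun l => firstRen T l = t),
        x ^ l.length = x ^ (low t l).length * x ^ (highStd t l).length := fun l _ => by
      rw [← pow_add, ← length_eq_low_add_highStd]
    rw [sum_congr rfl heq]
    refine sum_le_sum_of_injOn_of_nonneg (fun l : List HV => (low t l, highStd t l)) ?_ ?_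
      (fun p => x ^ p.1.length * x ^ p.2.length) (fun _ _ => mul_nonneg (pow_nonneg hx _) (pow_nonneg hx _))
    · intro l _ l' _ h
      simp only [Prod.mk.injEq] at h
      exact eq_of_low_eq_of_highStd_eq h.1 h.2
    · intro l hl
      rw [mem_filter] at hl
      obtain ⟨hr, hmin⟩ := firstRen_spec hl.2 htT
      rw [mem_product, irrLists, mem_filter]
      exact ⟨⟨low_mem_bridgeLists hT ht1 hl.1 hr, isIrred_low hr hmin⟩, highStd_mem_bridgeLists hT ht1 htT hl.1 hr⟩


/-! ### The limits `I_T(x_c)` and the renewal equation -/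

section Limits

open Filter Topology

/-- `I_{T,L}(x)` is non-decreasing in `L` (`T ≥ 1`, `x ≥ 0`). [cite: Kesten1963SAW, §4] -/
theorem stripI_mono_L {T L L' : ℕ} (hT : 1 ≤ T) (h : L ≤ L') {x : ℝ} (hx : 0 ≤ x) : stripI T L x ≤ stripI T L' x := by
  rw [stripI, stripI]
  refine sum_le_sum_of_subset_of_nonneg (fun l hl => ?_) fun _ _ _ => pow_nonneg hx _
  rw [irrLists, mem_filter] at hl ⊢
  exact ⟨bridgeLists_mono_L hT h hl.1, hl.2⟩

/-- `I_{T,L}(x_c) ≤ 1`. [cite: Kesten1963SAW, §4; DuminilCopinSmirnov2012, Lemma 2] -/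
theorem stripI_le_one {T : ℕ} (hT : 1 ≤ T) (L : ℕ) : stripI T L hexCriticalFugacity ≤ 1 :=
  (stripI_le_stripB hT L hexCriticalFugacity_pos_lt_one.1.le).trans
    (stripB_le_one_of_lemma2 DuminilCopinSmirnov2012_lemma2_holds hT L)

/-- `I_T(x_c) := lim_L I_{T,L}(x_c) = sup_L I_{T,L}(x_c)`, the critical weight of the irreducible bridges of width `T`
of the infinite strip `S_T`. [cite: Kesten1963SAW, §4] -/
def stripIlim (T : ℕ) : ℝ := ⨆ L : ℕ, stripI T L hexCriticalFugacity

/-- The finite-volume `I_{T,L}(x_c)` are bounded (by `1`). [folklore] -/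
theorem bddAbove_stripI {T : ℕ} (hT : 1 ≤ T) :
    BddAbove (Set.range fun L : ℕ => stripI T L hexCriticalFugacity) :=
  ⟨1, by rintro _ ⟨L, rfl⟩; exact stripI_le_one hT L⟩

/-- `I_{T,L} ≤ I_T`. [cite: Kesten1963SAW, §4] -/
theorem stripI_le_lim {T : ℕ} (hT : 1 ≤ T) (L : ℕ) : stripI T L hexCriticalFugacity ≤ stripIlim T :=
  le_ciSup (bddAbove_stripI hT) L

/-- `I_{T,L} → I_T`. [cite: Kesten1963SAW, §4] -/
theorem tendsto_stripI {T : ℕ} (hT : 1 ≤ T) :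
    Tendsto (fun L : ℕ => stripI T L hexCriticalFugacity) atTop (𝓝 (stripIlim T)) :=
  tendsto_atTop_ciSup (fun _ _ h => stripI_mono_L hT h hexCriticalFugacity_pos_lt_one.1.le) (bddAbove_stripI hT)

/-- `0 ≤ I_T`. [folklore] -/
theorem stripIlim_nonneg {T : ℕ} (hT : 1 ≤ T) : 0 ≤ stripIlim T :=
  (stripI_nonneg T 0 hexCriticalFugacity_pos_lt_one.1.le).trans (stripI_le_lim hT 0)

/-- `I_T ≤ 1`. [cite: Kesten1963SAW, §4] -/
theorem stripIlim_le_one {T : ℕ} (hT : 1 ≤ T) : stripIlim T ≤ 1 := ciSup_le fun L => stripI_le_one hT L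

/-- **The renewal equation at criticality**: `B_T = I_T + Σ_{1 ≤ t < T} I_t B_{T-t}` for every `T ≥ 1` (Kesten;
Madras–Slade (4.2.2) `bₙ = Σ λ_k b_{n-k}`, here in the width grading of Duminil-Copin–Smirnov's strips).
[cite: Kesten1963SAW, §4; MadrasSlade1993, (4.2.2)] -/
theorem renewal_equation {T : ℕ} (hT : 1 ≤ T) :
    stripBlim T = stripIlim T + ∑ t ∈ Ico 1 T, stripIlim t * stripBlim (T - t) := by
  have h0 := hexCriticalFugacity_pos_lt_one.1.le
  have hlem := DuminilCopinSmirnov2012_lemma2_holds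
  apply le_antisymm
  · -- `≤`: the cutting inequality, bounded termwise by the limits
    refine ciSup_le fun L => (stripB_le_cut hT L h0).trans (add_le_add (stripI_le_lim hT L) ?_)
    refine sum_le_sum fun t ht => ?_
    rw [mem_Ico] at ht
    exact mul_le_mul (stripI_le_lim ht.1 L) (stripB_le_lim hlem (by omega) _) (stripB_nonneg h0)
      (stripIlim_nonneg ht.1)
  · -- `≥`: the concatenation inequality in the limit `L → ∞`
    have hlim : Tendsto (fun L : ℕ => stripI T L hexCriticalFugacity +
        ∑ t ∈ Ico 1 T, stripI t L hexCriticalFugacity * stripB (T - t) L hexCriticalFugacity) atTop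
        (𝓝 (stripIlim T + ∑ t ∈ Ico 1 T, stripIlim t * stripBlim (T - t))) := by
      refine (tendsto_stripI hT).add (tendsto_finsetSum _ fun t ht => ?_)
      rw [mem_Ico] at ht
      exact (tendsto_stripI ht.1).mul (tendsto_stripB hlem (by omega))
    exact le_of_tendsto' hlim fun L =>
      (sum_brConcat_le_stripB hT L h0).trans (stripB_le_lim hlem hT _)

/-! ### Kesten's identity `Σ_T I_T(x_c) = 1` -/

/-- The renewal equation reindexed à la Feller: for `m : ℕ`,
`B_{m+1} = Σ_{k < m} I_{k+1} B_{m-k} + I_{m+1}`. [cite: Kesten1963SAW, §4; Feller1968, XIII.3] -/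
theorem renewal_equation_range (m : ℕ) :
    stripBlim (m + 1) = ∑ k ∈ range m, stripIlim (k + 1) * stripBlim (m - k) + stripIlim (m + 1) := by
  rw [renewal_equation (by omega : 1 ≤ m + 1), sum_Ico_eq_sum_range, add_comm]
  have hm : m + 1 - 1 = m := by omega
  rw [hm, add_left_inj]
  refine sum_congr rfl fun k hk => ?_
  rw [mem_range] at hk
  have h1 : 1 + k = k + 1 := add_comm 1 k
  have h2 : m + 1 - (k + 1) = m - k := by omega
  rw [h1, h2]

/-- The critical bridge weights are NOT summable: `Σ_T B_T(x_c) = ∞` (Duminil-Copin–Smirnov).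
[cite: DuminilCopinSmirnov2012, §3; Kesten1963SAW, §4] -/
theorem not_summable_bridgeSeq : ¬ Summable (fun m : ℕ => if m = 0 then (1 : ℝ) else stripBlim m) := by
  intro hs
  have hs1 : Summable fun T : ℕ => stripBlim (T + 1) := by
    have := (summable_nat_add_iff 1).2 hs
    simpa using this
  have hnn : ∀ T, 0 ≤ stripBlim (T + 1) := fun T => stripBlim_nonneg (by omega)
  have hbd : ∀ N, ∑ T ∈ range N, stripBlim (T + 1) ≤ ∑' T, stripBlim (T + 1) := fun N =>
    hs1.sum_le_tsum (range N) fun T _ => hnn T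
  obtain ⟨N, hN⟩ := (tendsto_atTop.1 tendsto_sum_stripBlim_atTop (∑' T, stripBlim (T + 1) + 1)).exists
  linarith [hbd N]

/-- **Kesten's identity on the hexagonal lattice**: the critical weights of the irreducible bridges sum to ONE,
`Σ_{T ≥ 1} I_T(x_c) = 1` — the irreducible bridges form a probability distribution at `x_c = 1/√(2+√2)`, i.e. the
critical bridge decomposition is a proper (recurrent) renewal structure.  (Kesten proved `Σₙ λₙ μ⁻ⁿ = 1` on `ℤᵈ`;
here the input `Σ_T B_T(x_c) = ∞` is Duminil-Copin–Smirnov's; the honeycomb statement is printed, as an "easy adaptation"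
without proof, by Beaton–Bousquet-Mélou–de Gier–Duminil-Copin–Guttmann.) [cite: Kesten1963SAW, §4 (Thm. 5 / (4.13)); MadrasSlade1993, §4.2, eq. (4.2.4) (p. 91); BeatonBousquetMelouDeGierDuminilCopinGuttmann2014, Appendix (display before Lemma 11: "Σ_{γ∈iSAB} x_c^{|γ|} = 1")] -/
theorem hasSum_stripIlim : HasSum (fun T : ℕ => stripIlim (T + 1)) 1 := by
  set u : ℕ → ℝ := fun m => if m = 0 then 1 else stripBlim m with hu
  set f : ℕ → ℝ := fun t => if t = 0 then 0 else stripIlim t with hf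
  have hlem := DuminilCopinSmirnov2012_lemma2_holds
  have hu0 : u 0 = 1 := if_pos rfl
  have hunn : ∀ n, 0 ≤ u n := fun n => by
    rcases Nat.eq_zero_or_pos n with rfl | hn
    · rw [hu0]; norm_num
    · simp only [hu, if_neg hn.ne']; exact stripBlim_nonneg hn
  have hu1 : ∀ n, u n ≤ 1 := fun n => by
    rcases Nat.eq_zero_or_pos n with rfl | hn
    · rw [hu0]
    · simp only [hu, if_neg hn.ne']
      exact ciSup_le fun L => stripB_le_one_of_lemma2 hlem hn L
  have hfnn : ∀ k, 0 ≤ f k := fun k => by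
    rcases Nat.eq_zero_or_pos k with rfl | hk
    · simp [hf]
    · simp only [hf, if_neg hk.ne']; exact stripIlim_nonneg hk
  have hf0 : f 0 = 0 := if_pos rfl
  have hren : ∀ n, 1 ≤ n → u n = ∑ k ∈ range (n + 1), f k * u (n - k) := by
    intro n hn
    obtain ⟨m, rfl⟩ : ∃ m, n = m + 1 := ⟨n - 1, by omega⟩
    have hun : u (m + 1) = stripBlim (m + 1) := if_neg (Nat.succ_ne_zero m)
    rw [hun, renewal_equation_range m, sum_range_succ', hf0, zero_mul, add_zero, sum_range_succ]
    have hlast : f (m + 1) * u (m + 1 - (m + 1)) = stripIlim (m + 1) := by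
      rw [Nat.sub_self, hu0, mul_one]; exact if_neg (Nat.succ_ne_zero m)
    rw [hlast, add_left_inj]
    refine sum_congr rfl fun k hk => ?_
    rw [mem_range] at hk
    have hfk : f (k + 1) = stripIlim (k + 1) := if_neg (Nat.succ_ne_zero k)
    have hmk : m + 1 - (k + 1) = m - k := by omega
    have huk : u (m - k) = stripBlim (m - k) := if_neg (by omega)
    rw [hfk, hmk, huk]
  have key := Literature.Probability.Process.Renewal.hasSum_f_one hu0 hunn hu1 hfnn hf0 hren not_summable_bridgeSeq
  have := (hasSum_nat_add_iff' (f := f) 1).2 key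
  simpa [hf] using this

/-- `Σ_{T ≥ 1} I_T(x_c) = 1` as a `tsum`. [cite: Kesten1963SAW, §4] -/
theorem tsum_stripIlim : ∑' T : ℕ, stripIlim (T + 1) = 1 := hasSum_stripIlim.tsum_eq

end Limits


/-! ### Null recurrence: the critical irreducible bridges have infinite mean width -/

section NullRecurrence

open Filter Topology

/-- **Null recurrence of the critical bridge renewal on the hexagonal lattice**: the widths of the irreducible bridges
have INFINITE MEAN at `x_c`, `Σ_{T ≥ 1} T · I_T(x_c) = ∞`.  Indeed the renewal is recurrent (`hasSum_stripIlim`) and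
`B_T(x_c) → 0` (Beaton–Bousquet-Mélou–de Gier–Duminil-Copin–Guttmann / Glazman–Manolescu, `tendsto_stripBlim`), while a
finite mean `μ` would force `(1-s) Σ_T B_T sᵀ ≥ 1/μ` (`Renewal.not_summable_mul_of_tendsto_zero`); equivalently, by the
renewal theorem, `B_T → 1/μ` forces `μ = ∞`.  (Renewal levels of the critical SAW are recurrent but SPARSE.)
[cite: Kesten1963SAW, §4; Feller1968, XIII.4; GlazmanManolescu2019, Proposition 1.1] -/
theorem not_summable_width_mul_stripIlim : ¬ Summable fun T : ℕ => ((T : ℝ) + 1) * stripIlim (T + 1) := by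
  set u : ℕ → ℝ := fun m => if m = 0 then 1 else stripBlim m with hu
  set f : ℕ → ℝ := fun t => if t = 0 then 0 else stripIlim t with hf
  have hlem := DuminilCopinSmirnov2012_lemma2_holds
  have hu0 : u 0 = 1 := if_pos rfl
  have hunn : ∀ n, 0 ≤ u n := fun n => by
    rcases Nat.eq_zero_or_pos n with rfl | hn
    · rw [hu0]; norm_num
    · simp only [hu, if_neg hn.ne']; exact stripBlim_nonneg hn
  have hu1 : ∀ n, u n ≤ 1 := fun n => by
    rcases Nat.eq_zero_or_pos n with rfl | hn
    · rw [hu0]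
    · simp only [hu, if_neg hn.ne']
      exact ciSup_le fun L => stripB_le_one_of_lemma2 hlem hn L
  have hfnn : ∀ k, 0 ≤ f k := fun k => by
    rcases Nat.eq_zero_or_pos k with rfl | hk
    · simp [hf]
    · simp only [hf, if_neg hk.ne']; exact stripIlim_nonneg hk
  have hf0 : f 0 = 0 := if_pos rfl
  have hren : ∀ n, 1 ≤ n → u n = ∑ k ∈ range (n + 1), f k * u (n - k) := by
    intro n hn
    obtain ⟨m, rfl⟩ : ∃ m, n = m + 1 := ⟨n - 1, by omega⟩
    have hun : u (m + 1) = stripBlim (m + 1) := if_neg (Nat.succ_ne_zero m)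
    rw [hun, renewal_equation_range m, sum_range_succ', hf0, zero_mul, add_zero, sum_range_succ]
    have hlast : f (m + 1) * u (m + 1 - (m + 1)) = stripIlim (m + 1) := by
      rw [Nat.sub_self, hu0, mul_one]; exact if_neg (Nat.succ_ne_zero m)
    rw [hlast, add_left_inj]
    refine sum_congr rfl fun k hk => ?_
    rw [mem_range] at hk
    have hfk : f (k + 1) = stripIlim (k + 1) := if_neg (Nat.succ_ne_zero k)
    have hmk : m + 1 - (k + 1) = m - k := by omega
    have huk : u (m - k) = stripBlim (m - k) := if_neg (by omega)
    rw [hfk, hmk, huk]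
  -- recurrence (Kesten) and `uₙ → 0` (bridge decay)
  have hf1 : HasSum f 1 := by
    rw [← hasSum_nat_add_iff' 1]
    simpa [hf] using hasSum_stripIlim
  have hlim : Tendsto u atTop (𝓝 0) := by
    refine tendsto_stripBlim.congr' ?_
    filter_upwards [Filter.eventually_ge_atTop 1] with n hn
    exact (if_neg (by omega : n ≠ 0)).symm
  have key := Literature.Probability.Process.Renewal.not_summable_mul_of_tendsto_zero hu0 hunn hu1 hfnn hf0 hren hf1 hlim
  intro hS
  apply key
  rw [← summable_nat_add_iff 1]
  refine hS.congr fun T => ?_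
  simp only [hf, if_neg (Nat.succ_ne_zero T)]
  push_cast
  ring

end NullRecurrence

end HV

end Literature.Probability.RandomPlanarGeometry.SAW

end
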